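/-
Copyright: the b2b-balaban T⁴-continuum CRUX team, row NE7b OWNER lineage `t4-ne7b-p1` (gen 147). Project licence.
-/
import Summits.QuantumFields.BalabanUV.T4Continuum.Spine.NE7b.SupWeightedClassMapOrderThree

/-!
# THE WEIGHTED CLASS MAP PACKAGED AT ORDER THREE — THE OPERATOR LETTER (SCOPING-d18 §E F20; file (750)).  At order 3 the weighted class
# carries the three full-graph letters of the third-derivative majorant `|U₃(φ)[e_u,e_x,e_y]| ≤ K3_{xyu}`: `Σ_{y,v}K3_{xyv}ϑ₂ϑ₂ϑ₂ ≤ k3rϑ` (`x`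
# fixed), `k3mϑ` (`y` fixed), `k3cϑ` (`v` fixed).  (483) put the OUTPUT third derivative `T(ψ)` of `W⁺(ψ) = −log∫e^{−U(·+ψ)}dμ_{AAᵀ}` in the
# input's entry format `|T(ψ)[e_v,e_x,e_y]| ≤ M₃(v;x,y) = K3_{xyv} + E_D(g^{vy},b^x) + E_D(g^{vx},b^y) + E_D(b^v,g^{xy}) + C₃∕(ρ_{vx}ρ_{vy})`; (657)∕
# (658) summed `M₃` against the OUTPUT full-graph weight `ϑϑϑ` in the three roles GIVEN five profile letters `αθ, αθc, αg1m, αg2m, αg1c`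
# (and (483) itself needs the profiles `αθ`, `βθ` of its decay constant `C₃`); (659)∕(747) write every profile letter as intrinsic letter
# × factor letter.  THIS FILE composes them: for each role, `Σ_{free}|T(ψ)[…]|·ϑϑϑ ≤` the bound of (657)∕(658), and the operator letter
# `‖T(ψ)‖ ≤ √(B_x·B_y)` by Schur (481), from
#   — the road's step data ((483)'s hypotheses), the weights (`ϑ ≥ 1` symmetric submultiplicative, `ϑ² ≤ ϑ₂`, `ϑ² ≤ σσ`, `σ ≤ σθ`, `ρ⁸ ≤ σσ`,
#     the geometry letter `Sϑ2 = sup_vΣ_xϑ_{vx}²∕ρ_{vx}`, `D`'s weighted letters),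
#   — the INPUT's intrinsic letters `hrϑ, hcϑ, k3rϑ, k3mϑ, k3cϑ` (slot shapes, at `ϑ₂`), the FACTOR's weighted letters `αrσ, αcσ` under
#     `σ_{vz′} ≤ ϑ₂(v,u)σA_{uz′}`, and the scalar bookkeeping `hrϑ·αrσ ≤ αθ ≤ βθ`, `hcϑ·αcσ ≤ αθc`, `k3rϑ·αrσ ≤ αg1m`, `k3mϑ·αrσ ≤ αg2m`,
#     `k3cϑ·αcσ ≤ αg1c`
# — «ϑ₂-letters + factor letters in ⟹ ϑ-letters out» at order 3, NO profile hypothesis, no support count, no range (row NE7b, node U5c;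
# (483), (657), (658), (659), (747), (481) BY NAME; [folklore]).  Rates: (672)∕(746).

Cell `pub-balaban`, sub-cell `t4`, spine estimate NE7b (`T4WeightBudget.RelWeightBound`; the cell's OWN estimate — NOT PRINTED in
[Bałaban 1983–89], NOT PROVED).  Crux-route work under `Spine/NE7b/` by the row OWNER (`t4-ne7b-p1` gen 147, file (750)) under FREEZE
(0)'s crux-prover clause; NOTHING of Bałaban's is named as a Lean object, valued or asserted; no `T4Continuum/Support` leaf typed; no
`def`, no notation (`T(ψ)`, `M₃`'s bounds WRITTEN OUT as printed by (483)∕(657)∕(658)); zero `sorry`.  Imports (BY NAME): (749)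
`…SupWeightedClassMapOrderThree` (everything else through it).

WHAT IS PROVED ([folklore]): **`classmap_three_opNorm`** (the three slot letters are (749)'s `classmap_three_v∕x∕y`); toy.

HONEST (what this is NOT).  Order 3 of the packaging (orders 2, 4, 5: the sibling files); the derivative∕continuity slots of the class
carry no profile letter and are not restated; finite-torus Gaussian measure `μ_{AAᵀ}` with the road's regularisation; rates (672)∕(746);
scalar skeleton ((A3), NC-NE7b-α UNRULED); nothing of Bałaban's asserted.  BY-NAME EFFECT ON THE WALL: NONE.  NE7b NOT PRINTED ∕ NOT
PROVED; spine PROVED 0∕9; rung (B)+1 — the programme's measures remain FINITE-torus statements; NOT the mass gap, NOT Clay.  HONEST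
DEPENDENCY: continuum YM on T⁴ ⇐ BetaPertH ∧ nine spine estimates (0∕9 proved); BetaPertH ⇐ (D1) ∧ (D4) ∧ CAP+tail; G-an2-4 gates asym,
D1 and NE2∕3∕4.
-/

set_option autoImplicit false
set_option maxSynthPendingDepth 3

noncomputable section

namespace Summit.QuantumFields.BalabanUV.T4Continuum.NE7b.SupWeightedClassMapOrderThreeOperator

open MeasureTheory ProbabilityTheory Finset Real Matrix
open scoped BigOperators Matrix
open SupKernelSchurTrilinear (opNorm_le_of_slot_letters)
open SupWeightedClassMapOrderThree (classmap_three_x classmap_three_y)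

variable {ι κ : Type} [Fintype ι] [DecidableEq ι] [Fintype κ] [DecidableEq κ]

variable {U : EuclideanSpace ℝ ι → ℝ} {U' : EuclideanSpace ℝ ι → EuclideanSpace ℝ ι →L[ℝ] ℝ}
  {U'' : EuclideanSpace ℝ ι → EuclideanSpace ℝ ι →L[ℝ] EuclideanSpace ℝ ι →L[ℝ] ℝ}
  {U₃ : EuclideanSpace ℝ ι → EuclideanSpace ℝ ι →L[ℝ] EuclideanSpace ℝ ι →L[ℝ] EuclideanSpace ℝ ι →L[ℝ] ℝ} {Hk : ι → ι → ℝ} {K3 : ι → ι → ι → ℝ}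
  {A : Matrix ι κ ℝ} {D : κ → κ → ℝ} {γop κ₀ κ₁ κ₂ κ₃ a τ δ θp lam lamA αr αc hr γ dθ dθ' αθ βθ : ℝ} {θ : κ → κ → ℝ}
  {σ σA : ι → κ → ℝ} {ρ ϑ ϑ₂ : ι → ι → ℝ} {αθc αg1m αg2m αg1c αrσ αcσ hrϑ hcϑ k3rϑ k3mϑ k3cϑ Sϑ2 : ℝ}

set_option maxHeartbeats 800000 in
/-- **ORDER 3, THE OPERATOR LETTER READ OFF THE WEIGHTED LETTERS**: `‖T(ψ)‖ ≤ √(B_x·B_y)` with `B_x, B_y` the slot-`x`∕slot-`y` bounds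
above — Schur ((481)), the plain slot sums being at most the weighted ones (`ϑ ≥ 1`). [folklore] -/
theorem classmap_three_opNorm [Nonempty κ] (hΓop : (γop • (1 : Matrix ι ι ℝ) - A * Aᵀ).PosSemidef) (Y : Finset ι)
    (hUd : ∀ φ : EuclideanSpace ℝ ι, HasFDerivAt U (U' φ) φ) (hU'd : ∀ φ : EuclideanSpace ℝ ι, HasFDerivAt U' (U'' φ) φ)
    (hU''d : ∀ φ : EuclideanSpace ℝ ι, HasFDerivAt U'' (U₃ φ) φ) (hU₃c : Continuous U₃) (hκ₀ : 0 ≤ κ₀) (hκ₁ : 0 ≤ κ₁) (ha : 0 ≤ a) (hκ₂ : 0 ≤ κ₂)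
    (hκ₃ : 0 ≤ κ₃) (hτ : 0 < τ) (hδ : 0 < δ) (hθ0 : 0 < θp) (hθ1 : θp < 1) (hκθ : (2 * κ₀ * (1 + τ) + 4 * δ) * γop ≤ θp)
    (hκθw : 2 * κ₀ * (1 + τ) * γop + 4 * δ ≤ θp) (hstab : ∀ φ : EuclideanSpace ℝ ι, -(κ₀ * ∑ x ∈ Y, φ x ^ 2) ≤ U φ)
    (hU'b : ∀ φ : EuclideanSpace ℝ ι, ‖U' φ‖ ≤ κ₁ * (a + ∑ x ∈ Y, φ x ^ 2)) (hU''b : ∀ φ : EuclideanSpace ℝ ι, ‖U'' φ‖ ≤ κ₂)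
    (hU₃b : ∀ φ : EuclideanSpace ℝ ι, ‖U₃ φ‖ ≤ κ₃) (hlam : 0 ≤ lam)
    (hUsec : ∀ s : ℝ, 0 ≤ s → s ≤ 1 → ∀ a b : EuclideanSpace ℝ ι, U ((1 - s) • a + s • b) - lam / 2 * (s * (1 - s)) * ∑ i, (a i - b i) ^ 2 ≤ (1 - s)
      * U a + s * U b) (hρg : lam * γop < 1)
    (hHk : ∀ (φ : EuclideanSpace ℝ ι) (x z : ι), |U'' φ (EuclideanSpace.single z (1 : ℝ)) (EuclideanSpace.single x (1 : ℝ))| ≤ Hk x z)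
    (hHk0 : ∀ v u, 0 ≤ Hk v u)
    (hK3 : ∀ (φ : EuclideanSpace ℝ ι) (u x y : ι), |U₃ φ (EuclideanSpace.single u (1 : ℝ)) (EuclideanSpace.single x (1 : ℝ))
      (EuclideanSpace.single y (1 : ℝ))| ≤ K3 x y u) (hhr : ∀ v, ∑ u, Hk v u ≤ hr) (ψ : EuclideanSpace ℝ ι) (hαr : ∀ u, ∑ w, |A u w| ≤ αr)
    (hαc : ∀ w, ∑ u, |A u w| ≤ αc) (hlamA : ∀ x : κ, ∑ u, ∑ v, |A u x| * |A v x| * Hk v u ≤ lamA) (hlamA1 : lamA < 1)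
    (hγ : αc * hr * αr / (1 - lamA) ≤ γ) (hγ1 : γ < 1) (hD : ∀ x y, 0 ≤ D x y)
    (hDC : ∀ x y, (if x = y then (1 : ℝ) else 0) + ∑ z, D x z * ((if y = z then 0 else ∑ u, ∑ v, |A u y| * |A v z| * Hk v u) / (1 - lamA)) ≤ D x y)
    (hθw1 : ∀ z w, 1 ≤ θ z w) (hDr : ∀ z, ∑ w, D z w * θ z w ≤ dθ) (hdθ : 0 ≤ dθ) (hDc : ∀ w, ∑ z, D z w * θ z w ≤ dθ') (hdθ' : 0 ≤ dθ')
    (hσ0 : ∀ x w, 0 ≤ σ x w) (hσθ : ∀ x z w, σ x w ≤ σ x z * θ z w) (hρ1 : ∀ x y, 1 ≤ ρ x y) (hρsymm : ∀ x y, ρ x y = ρ y x)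
    (hρmul : ∀ x y z, ρ x z ≤ ρ x y * ρ y z) (hρσ : ∀ x y w, ρ x y ^ 8 ≤ σ x w * σ y w)
    (hϑ1 : ∀ x y, 1 ≤ ϑ x y) (hϑsymm : ∀ x y, ϑ x y = ϑ y x) (hϑmul : ∀ x y z, ϑ x z ≤ ϑ x y * ϑ y z) (hϑ2 : ∀ x y, ϑ x y * ϑ x y ≤ ϑ₂ x y)
    (hϑ₂symm : ∀ x y, ϑ₂ x y = ϑ₂ y x) (hϑσ : ∀ x y w, ϑ x y * ϑ x y ≤ σ x w * σ y w) (hS2 : ∀ v, ∑ x, ϑ v x * ϑ v x / ρ v x ≤ Sϑ2)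
    (hσA0 : ∀ u z', 0 ≤ σA u z') (hσϑ₂ : ∀ v u z', σ v z' ≤ ϑ₂ v u * σA u z') (hAr : ∀ u, ∑ z', |A u z'| * σA u z' ≤ αrσ) (hαrσ : 0 ≤ αrσ)
    (hAc : ∀ z', ∑ u, |A u z'| * σA u z' ≤ αcσ) (hαcσ : 0 ≤ αcσ)
    (hhrw : ∀ a, ∑ b, ϑ₂ a b * Hk a b ≤ hrϑ) (hhc : ∀ a, ∑ b, ϑ₂ a b * Hk b a ≤ hcϑ)
        (hk3r : ∀ x, ∑ y, ∑ v, K3 x y v * (ϑ₂ x y * ϑ₂ x v * ϑ₂ y v) ≤ k3rϑ) (hk3m : ∀ y, ∑ x, ∑ v, K3 x y v * (ϑ₂ y x * ϑ₂ y v * ϑ₂ x v) ≤ k3mϑ)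
        (hk3c : ∀ v, ∑ y, ∑ z, K3 y z v * (ϑ₂ v y * ϑ₂ v z * ϑ₂ y z) ≤ k3cϑ) (hαθ : hrϑ * αrσ ≤ αθ) (hαβ : αθ ≤ βθ) (hαθc : hcϑ * αcσ ≤ αθc)
        (hαg1m : k3rϑ * αrσ ≤ αg1m) (hαg2m : k3mϑ * αrσ ≤ αg2m) (hαg1c : k3cϑ * αcσ ≤ αg1c) :
    ‖(((∫ ω : EuclideanSpace ℝ ι, exp (-U (ω + ψ)) ∂(multivariateGaussian 0 (A * Aᵀ)))⁻¹ •
            (∫ ω : EuclideanSpace ℝ ι,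
              (exp (-U (ω + ψ)) •
                (U₃ (ω + ψ) -
                  (((ContinuousLinearMap.smulRightL ℝ (EuclideanSpace ℝ ι) (EuclideanSpace ℝ ι →L[ℝ] ℝ)) (U' (ω + ψ))).comp (U'' (ω + ψ)) +
                    (((ContinuousLinearMap.smulRightL ℝ (EuclideanSpace ℝ ι) (EuclideanSpace ℝ ι →L[ℝ] ℝ))).comp (U'' (ω + ψ))).flip (U' (ω + ψ))))
                + (exp (-U (ω + ψ)) • -U' (ω + ψ)).smulRight (U'' (ω + ψ) - (U' (ω + ψ)).smulRight (U' (ω + ψ)))) ∂(multivariateGaussian 0 (A * Aᵀ)))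
            +
            ((-((∫ ω : EuclideanSpace ℝ ι, exp (-U (ω + ψ)) ∂(multivariateGaussian 0 (A * Aᵀ))) ^ 2)⁻¹) •
              -(∫ ω : EuclideanSpace ℝ ι, exp (-U (ω + ψ)) • U' (ω + ψ) ∂(multivariateGaussian 0 (A * Aᵀ)))).smulRight
            (∫ ω : EuclideanSpace ℝ ι, exp (-U (ω + ψ)) • (U'' (ω + ψ) - (U' (ω + ψ)).smulRight (U' (ω + ψ))) ∂(multivariateGaussian 0 (A * Aᵀ)))) +
          (((ContinuousLinearMap.smulRightL ℝ (EuclideanSpace ℝ ι) (EuclideanSpace ℝ ι →L[ℝ] ℝ))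
              (((∫ ω : EuclideanSpace ℝ ι, exp (-U (ω + ψ)) ∂(multivariateGaussian 0 (A * Aᵀ))) ^ 2)⁻¹ •
                (∫ ω : EuclideanSpace ℝ ι, exp (-U (ω + ψ)) • U' (ω + ψ) ∂(multivariateGaussian 0 (A * Aᵀ))))).comp
            (∫ ω : EuclideanSpace ℝ ι, exp (-U (ω + ψ)) • (U'' (ω + ψ) - (U' (ω + ψ)).smulRight (U' (ω + ψ))) ∂(multivariateGaussian 0 (A * Aᵀ))) +
            (((ContinuousLinearMap.smulRightL ℝ (EuclideanSpace ℝ ι) (EuclideanSpace ℝ ι →L[ℝ] ℝ))).comp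
              (((∫ ω : EuclideanSpace ℝ ι, exp (-U (ω + ψ)) ∂(multivariateGaussian 0 (A * Aᵀ))) ^ 2)⁻¹ •
                (∫ ω : EuclideanSpace ℝ ι, exp (-U (ω + ψ)) • (U'' (ω + ψ) - (U' (ω + ψ)).smulRight (U' (ω + ψ))) ∂(multivariateGaussian 0 (A * Aᵀ)))
                +
                ((-2 / (∫ ω : EuclideanSpace ℝ ι, exp (-U (ω + ψ)) ∂(multivariateGaussian 0 (A * Aᵀ))) ^ 3) •
                  -(∫ ω : EuclideanSpace ℝ ι, exp (-U (ω + ψ)) • U' (ω + ψ) ∂(multivariateGaussian 0 (A * Aᵀ)))).smulRight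
                (∫ ω : EuclideanSpace ℝ ι, exp (-U (ω + ψ)) • U' (ω + ψ) ∂(multivariateGaussian 0 (A * Aᵀ))))).flip
            (∫ ω : EuclideanSpace ℝ ι, exp (-U (ω + ψ)) • U' (ω + ψ) ∂(multivariateGaussian 0 (A * Aᵀ)))))‖ ≤ Real.sqrt
        ((k3rϑ + (dθ * αθ * (dθ' * αg1c) / (1 - lamA) + dθ * αg2m * (dθ' * αθc) / (1 - lamA) + dθ * αg1m * (dθ' * αθc) / (1 - lamA)) + 4 * Real.sqrt
            (5 * (κ₂ ^ 4 * γop ^ 2) / (1 - lam * γop) ^ 2 * (αθ * dθ * (βθ * dθ') / (1 - lamA))) * Sϑ2 ^ 2) *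
          (k3mϑ + (dθ * αg2m * (dθ' * αθc) / (1 - lamA) + dθ * αθ * (dθ' * αg1c) / (1 - lamA) + dθ * αg2m * (dθ' * αθc) / (1 - lamA)) + 4 *
            Real.sqrt (5 * (κ₂ ^ 4 * γop ^ 2) / (1 - lam * γop) ^ 2 * (αθ * dθ * (βθ * dθ') / (1 - lamA))) * Sϑ2 ^ 2)) := by
  have hW1 : ∀ a b c d e f : ι, (1 : ℝ) ≤ ϑ a b * ϑ c d * ϑ e f := fun a b c d e f =>
    one_le_mul_of_one_le_of_one_le (one_le_mul_of_one_le_of_one_le (hϑ1 a b) (hϑ1 c d)) (hϑ1 e f)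
  refine opNorm_le_of_slot_letters _ (fun x => ?_) (fun y => ?_)
  · have h := classmap_three_x hΓop Y hUd hU'd hU''d hU₃c hκ₀ hκ₁ ha hκ₂ hκ₃ hτ hδ hθ0 hθ1 hκθ hκθw hstab hU'b hU''b hU₃b hlam hUsec hρg hHk hHk0
      hK3 hhr ψ hαr hαc hlamA hlamA1 hγ hγ1 hD hDC hθw1 hDr hdθ hDc hdθ' hσ0 hσθ hρ1 hρsymm hρmul hρσ hϑ1 hϑsymm hϑmul hϑ2 hϑ₂symm hϑσ hS2 hσA0 hσϑ₂
      hAr hαrσ hAc hαcσ hhrw hhc hk3r hk3m hk3c hαθ hαβ hαθc hαg1m hαg2m hαg1c x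
    rw [Finset.sum_comm] at h
    exact le_trans (sum_le_sum fun v _ => sum_le_sum fun y _ => le_mul_of_one_le_right (abs_nonneg _) (hW1 x y x v y v)) h
  · have h := classmap_three_y hΓop Y hUd hU'd hU''d hU₃c hκ₀ hκ₁ ha hκ₂ hκ₃ hτ hδ hθ0 hθ1 hκθ hκθw hstab hU'b hU''b hU₃b hlam hUsec hρg hHk hHk0
      hK3 hhr ψ hαr hαc hlamA hlamA1 hγ hγ1 hD hDC hθw1 hDr hdθ hDc hdθ' hσ0 hσθ hρ1 hρsymm hρmul hρσ hϑ1 hϑsymm hϑmul hϑ2 hϑ₂symm hϑσ hS2 hσA0 hσϑ₂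
      hAr hαrσ hAc hαcσ hhrw hhc hk3m hk3c hαθ hαβ hαθc hαg2m hαg1c y
    rw [Finset.sum_comm] at h
    exact le_trans (sum_le_sum fun v _ => sum_le_sum fun x _ => le_mul_of_one_le_right (abs_nonneg _) (hW1 y x y v x v)) h

/-! ## Toy -/

/-- Toy (plain ≤ weighted): `3 ≤ 3·(1·1·2)`. -/
example : (3 : ℝ) ≤ 3 * (1 * 1 * 2) := by norm_num

end Summit.QuantumFields.BalabanUV.T4Continuum.NE7b.SupWeightedClassMapOrderThreeOperator

end
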